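import Summits.MatrixMultiplication.OmegaCensus.DicyclicNoSubFourP5
import Summits.MatrixMultiplication.OmegaCensus.CubeStructureTPP
import Summits.MatrixMultiplication.OmegaCensus.DicyclicOddCharacters
import HarnessLib

/-!
# Structure of a `law − 4` triple of shape P3 in dicyclic type: the big `ρ`-part is `⟨c₀⟩`-periodic

ω-census, family (b3).  Framing: lottery ticket; floor = certified bounds/negative ranges.

Dihedral-like `G(A, c₀)` with `c₀ ≠ 0`.  After `DicyclicNoSubFourP5.lean` the only `law − 4` shape left in dicyclic type
is P3: coset parts `(c+1, c | 1,1 | 3,3)` up to roles, `|A| = 9c + 7`, and `c` is ODD (`|A|` is even).  No such triple is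
known; all dicyclic-type groups with `|A| = 16` have none (seat census, exhaustive), the dihedral types `D₃₂`, `C₂ × D₁₆`
have thousands.  This file proves the first structure theorem towards the conjectured non-existence.

**Theorem (`dicyclic_P3_rho_part_periodic`).** For a TPP triple with parts `(s₁+1, s₁ | 1,1 | 3,3)` (`ρ`-part of `S` the
larger one, `T = {ρ t, τ b}`) and `3|S||T||U| + 20 = 8|A|` in dicyclic type, the `ρ`-part `S₀` of `S` is `c₀`-PERIODIC
(`S₀ + c₀ = S₀`); so are the boxes `S₀ + b + U₀` and `S₀ + b + (c₀ − U₁)` (`P3_face_periodic`).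

**Proof.** (1) The vertex-`000` boxes `S₁+t+U₀ ⊔ S₀+b+U₀ ⊔ S₀+t+U₁` miss exactly one point `p` (slack `1`); the same
vertex of the `T`-translate `(S, T·τ0, U)` misses one point and its outer boxes are the old ones shifted by
`d = −c₀−b−t`, the middle one by `e = −t−b`; hence `S₀+b+U₀ + (e−d) = S₀+b+U₀ + c₀ ⊆ (S₀+b+U₀) ∪ {p}`
(`near_shift_subset`), and a set that is `c₀`-periodic up to one point and has EVEN size `3(s₁+1)` (`s₁` is odd as
`|A| = 9s₁+7` is even) is periodic (`periodic_of_subset_insert`).  (2) The same for the `U`-translate `(S, T, U·τ0)`, whose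
`U`-parts are `(c₀ − U₁, −U₀)`.  (3) Fourier: a `c₀`-periodic set has vanishing sums at every ODD character
(`ψ(c₀) = −1`), so `σ₀·ψ(b)·υ₀ = 0 = σ₀·ψ(b)·ψ̂(c₀−U₁)` there; if `σ₀(ψ) ≠ 0` then `υ₀ = 0`, hence `ψ̂(−U₀) = ῡ₀ = 0`, and
`ψ̂(c₀ − U₁) = 0`, so the vertex-`000` identity of `(S, T, U·τ0)` (`vertex000_charsum`) reads `0 = −ψ(p'')`, absurd.
Thus `σ₀` vanishes at all odd characters, which is periodicity (`periodic_of_charsum_eq_zero` of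
`DicyclicOddCharacters.lean`, character inversion).
-/

namespace Summit.MatrixMultiplication.OmegaCensus

open Literature.Combinatorics.Additive Finset

section Shift

variable {A : Type*} [AddCommGroup A] [DecidableEq A]

/-- A set that is `c₀`-periodic up to one extra point (`Q + c₀ ⊆ Q ∪ {p}`) and has even size is `c₀`-periodic
(`c₀ ≠ 0 = 2c₀`). [folklore] -/
theorem periodic_of_subset_insert {Q : Finset A} {c₀ p : A} (hc₀ : c₀ ≠ 0) (h2c : c₀ + c₀ = 0)
    (hsub : Q.image (· + c₀) ⊆ insert p Q) (heven : 2 ∣ Q.card) : Q.image (· + c₀) = Q := by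
  -- `H` = the elements of `Q` whose partner is missing: at most one
  set H := Q.filter (fun x => ¬ (x + c₀ ∈ Q)) with hH
  have hH1 : ∀ x ∈ H, x + c₀ = p := by
    intro x hx
    rw [hH, mem_filter] at hx
    have hx' : x + c₀ ∈ insert p Q := hsub (mem_image_of_mem _ hx.1)
    rcases mem_insert.1 hx' with h | h
    · exact h
    · exact absurd h hx.2
  have hHcard : H.card ≤ 1 := card_le_one.2 fun x hx y hy => add_right_cancel ((hH1 x hx).trans (hH1 y hy).symm)
  -- the rest `Q'` is periodic, hence of even size
  set Q' := Q.filter (fun x => x + c₀ ∈ Q) with hQ'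
  have hper' : Q'.image (· + c₀) = Q' := by
    apply eq_of_subset_of_card_le _ (by rw [card_image_of_injective _ (add_left_injective c₀)])
    intro y hy
    obtain ⟨x, hx, rfl⟩ := mem_image.1 hy
    rw [hQ', mem_filter] at hx ⊢
    exact ⟨hx.2, by rw [add_assoc, h2c, add_zero]; exact hx.1⟩
  have hev' := card_even_of_periodic hper' hc₀ h2c
  have hsplit : Q'.card + H.card = Q.card := by
    rw [hQ', hH]; exact card_filter_add_card_filter_not _
  have hH0 : H = ∅ := card_eq_zero.1 (by omega)
  apply eq_of_subset_of_card_le _ (by rw [card_image_of_injective _ (add_left_injective c₀)])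
  intro y hy
  obtain ⟨x, hx, rfl⟩ := mem_image.1 hy
  by_contra hxc
  have hmem : x ∈ H := by rw [hH, mem_filter]; exact ⟨hx, hxc⟩
  rw [hH0] at hmem
  simp at hmem

variable [Fintype A]

/-- **Two near-tilings sharing two shifted tiles.** `P ⊔ Q ⊔ R = A ∖ {p}`; `P', Q', R'` with `P' = P + d`,
`R' = R + d`, `Q' = Q + e`, `Q'` disjoint from `P'` and `R'`: then `Q + (e − d) ⊆ Q ∪ {p}`. [folklore] -/
theorem near_shift_subset {P Q R P' Q' R' : Finset A} (d e : A) {p : A} (hp : univ \ (P ∪ Q ∪ R) = {p})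
    (hP'Q' : Disjoint P' Q') (hQ'R' : Disjoint Q' R')
    (hP' : P' = P.image (· + d)) (hR' : R' = R.image (· + d)) (hQ' : Q' = Q.image (· + e)) :
    Q.image (· + (e - d)) ⊆ insert p Q := by
  intro y hy
  obtain ⟨q, hq, rfl⟩ := mem_image.1 hy
  have hqe : q + e ∈ Q' := hQ' ▸ mem_image_of_mem _ hq
  have h1 : q + (e - d) ∉ P := fun h => by
    have h' : q + (e - d) + d ∈ P' := hP' ▸ mem_image_of_mem _ h
    rw [show q + (e - d) + d = q + e by abel] at h'
    exact disjoint_left.1 hP'Q' h' hqe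
  have h2 : q + (e - d) ∉ R := fun h => by
    have h' : q + (e - d) + d ∈ R' := hR' ▸ mem_image_of_mem _ h
    rw [show q + (e - d) + d = q + e by abel] at h'
    exact disjoint_right.1 hQ'R' h' hqe
  by_cases hQ : q + (e - d) ∈ Q
  · exact mem_insert_of_mem hQ
  · have hmem : q + (e - d) ∈ univ \ (P ∪ Q ∪ R) := by
      simp only [mem_sdiff, mem_univ, mem_union, true_and, not_or]
      exact ⟨⟨h1, hQ⟩, h2⟩
    rw [hp, mem_singleton] at hmem
    rw [hmem]; exact mem_insert_self _ _

end Shift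


section DihedralLike

variable {A : Type*} [AddCommGroup A] [DecidableEq A] [Fintype A] {G : Type} [Group G] [DecidableEq G]
  {ρ τ : A → G} {c₀ : A} {S T U : Finset G}

/-- **The middle box of the big-part face is periodic.** Dicyclic type; TPP triple with parts `(s₁+1, s₁ | 1,1 | 3,3)`
and `3|S||T||U| + 20 = 8|A|`: the box `S₀ + T₁ + U₀` is `c₀`-periodic. [folklore] -/
theorem P3_face_periodic
    (hρρ : ∀ a b, ρ a * ρ b = ρ (a + b)) (hρτ : ∀ a b, ρ a * τ b = τ (b - a))
    (hτρ : ∀ a b, τ a * ρ b = τ (a + b)) (hττ : ∀ a b, τ a * τ b = ρ (c₀ + b - a)) (hc₀ : c₀ ≠ 0)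
    (hρ : Function.Injective ρ) (hτ : Function.Injective τ) (hne : ∀ a b, ρ a ≠ τ b)
    (hsurj : ∀ g, (∃ a, ρ a = g) ∨ (∃ a, τ a = g)) (h : TripleProductProperty S T U)
    (hs : (univ.filter fun a : A => ρ a ∈ S).card = (univ.filter fun a : A => τ a ∈ S).card + 1)
    (ht₀ : (univ.filter fun a : A => ρ a ∈ T).card = 1) (ht₁ : (univ.filter fun a : A => τ a ∈ T).card = 1)
    (hu₀ : (univ.filter fun a : A => ρ a ∈ U).card = 3) (hu₁ : (univ.filter fun a : A => τ a ∈ U).card = 3)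
    (hV : 3 * (S.card * T.card * U.card) + 20 = 8 * Fintype.card A) :
    (((univ.filter fun a : A => ρ a ∈ S) ×ˢ (univ.filter fun a : A => τ a ∈ T) ×ˢ
        (univ.filter fun a : A => ρ a ∈ U)).image fun p : A × A × A => p.1 + p.2.1 + p.2.2).image (· + c₀) =
      ((univ.filter fun a : A => ρ a ∈ S) ×ˢ (univ.filter fun a : A => τ a ∈ T) ×ˢ
        (univ.filter fun a : A => ρ a ∈ U)).image fun p : A × A × A => p.1 + p.2.1 + p.2.2 := by
  set S₀ : Finset A := univ.filter fun a => ρ a ∈ S with hS₀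
  set S₁ : Finset A := univ.filter fun a => τ a ∈ S with hS₁
  set T₀ : Finset A := univ.filter fun a => ρ a ∈ T with hT₀
  set T₁ : Finset A := univ.filter fun a => τ a ∈ T with hT₁
  set U₀ : Finset A := univ.filter fun a => ρ a ∈ U with hU₀
  set U₁ : Finset A := univ.filter fun a => τ a ∈ U with hU₁
  have h2c := two_c0_eq_zero hρτ hτρ hττ hτ
  -- numerics: `|A| = 9 s₁ + 7` is even, so `s₁` is odd
  have cS : S.card = S₀.card + S₁.card := card_eq_parts' hρ hτ hne hsurj S
  have cT : T.card = T₀.card + T₁.card := card_eq_parts' hρ hτ hne hsurj T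
  have cU : U.card = U₀.card + U₁.card := card_eq_parts' hρ hτ hne hsurj U
  rw [cS, cT, cU, hs, ht₀, ht₁, hu₀, hu₁] at hV
  have hNeven : 2 ∣ Fintype.card A := by
    have ho : addOrderOf c₀ = 2 := addOrderOf_eq_prime (by rw [two_nsmul, h2c]) hc₀
    rw [← ho]; exact addOrderOf_dvd_card
  obtain ⟨t, hT₀t⟩ := card_eq_one.1 ht₀
  obtain ⟨b, hT₁b⟩ := card_eq_one.1 ht₁
  have mS₀ : ∀ a ∈ S₀, cond false (τ a) (ρ a) ∈ S := fun a ha => by simpa [hS₀] using ha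
  have mS₁ : ∀ a ∈ S₁, cond true (τ a) (ρ a) ∈ S := fun a ha => by simpa [hS₁] using ha
  have mT₀ : ∀ a ∈ T₀, cond false (τ a) (ρ a) ∈ T := fun a ha => by simpa [hT₀] using ha
  have mT₁ : ∀ a ∈ T₁, cond true (τ a) (ρ a) ∈ T := fun a ha => by simpa [hT₁] using ha
  have mU₀ : ∀ a ∈ U₀, cond false (τ a) (ρ a) ∈ U := fun a ha => by simpa [hU₀] using ha
  have mU₁ : ∀ a ∈ U₁, cond true (τ a) (ρ a) ∈ U := fun a ha => by simpa [hU₁] using ha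
  -- vertex 000 of `(S, T, U)`: a near-tiling missing one point `p`
  have cs := card_sumset' hρρ hττ hρ hτ h
  have d₁ := disjoint_sumset₁' hρρ hρτ hτρ hττ hne h
  have d₂ := disjoint_sumset₂' hρρ hρτ hτρ hττ hne h
  have d₃ := disjoint_sumset₃' hρρ hρτ hτρ hττ hne h
  have hPQ := d₁ false mS₁ mT₀ mU₀ mS₀ mT₁
  have hPR := (d₃ false mS₀ mT₀ mU₁ mS₁ mU₀).symm
  have hQR := d₂ false mS₀ mT₁ mU₀ mS₀ mT₀ mU₁
  obtain ⟨p, hp⟩ := exists_missed_point hPQ hPR hQR (by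
    rw [cs true false false mS₁ mT₀ mU₀, cs false true false mS₀ mT₁ mU₀, cs false false true mS₀ mT₀ mU₁,
      hT₀t, hT₁b, card_singleton, card_singleton, hu₀, hu₁, hs]; omega)
  -- the `T`-translate and its vertex 000
  have er : (Equiv.mulRight (1 : G)).toEmbedding = Function.Embedding.refl G := by ext x; simp
  have hT' := h.map_mulRight 1 (τ 0) 1
  simp only [er, Finset.map_refl] at hT'
  set T' := T.map (Equiv.mulRight (τ 0)).toEmbedding with hT'def
  set T₀' : Finset A := univ.filter fun a => ρ a ∈ T' with hT₀'
  set T₁' : Finset A := univ.filter fun a => τ a ∈ T' with hT₁'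
  have eT₀' : T₀' = {-c₀ - b} := by
    rw [hT₀', hT'def, rho_part_mulRight_tau hρρ hρτ hττ, ← hT₁, hT₁b, image_singleton]
  have eT₁' : T₁' = {-t} := by
    rw [hT₁', hT'def, tau_part_mulRight_tau hρρ hττ, ← hT₀, hT₀t, image_singleton]
  have mT₀' : ∀ a ∈ T₀', cond false (τ a) (ρ a) ∈ T' := fun a ha => by simpa [hT₀'] using ha
  have mT₁' : ∀ a ∈ T₁', cond true (τ a) (ρ a) ∈ T' := fun a ha => by simpa [hT₁'] using ha
  have d₁' := disjoint_sumset₁' hρρ hρτ hτρ hττ hne hT'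
  have d₂' := disjoint_sumset₂' hρρ hρτ hτρ hττ hne hT'
  have hP'Q' := d₁' false mS₁ mT₀' mU₀ mS₀ mT₁'
  have hQ'R' := d₂' false mS₀ mT₁' mU₀ mS₀ mT₀' mU₁
  -- shift relations
  have hP' : ((S₁ ×ˢ T₀' ×ˢ U₀).image fun p : A × A × A => p.1 + p.2.1 + p.2.2) =
      (((S₁ ×ˢ T₀ ×ˢ U₀).image fun p : A × A × A => p.1 + p.2.1 + p.2.2)).image (· + (-c₀ - b - t)) := by
    rw [eT₀', hT₀t]; exact sumset₃_singleton_shift S₁ U₀ (-c₀ - b) t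
  have hR' : ((S₀ ×ˢ T₀' ×ˢ U₁).image fun p : A × A × A => p.1 + p.2.1 + p.2.2) =
      (((S₀ ×ˢ T₀ ×ˢ U₁).image fun p : A × A × A => p.1 + p.2.1 + p.2.2)).image (· + (-c₀ - b - t)) := by
    rw [eT₀', hT₀t]; exact sumset₃_singleton_shift S₀ U₁ (-c₀ - b) t
  have hQ'e : ((S₀ ×ˢ T₁' ×ˢ U₀).image fun p : A × A × A => p.1 + p.2.1 + p.2.2) =
      (((S₀ ×ˢ T₁ ×ˢ U₀).image fun p : A × A × A => p.1 + p.2.1 + p.2.2)).image (· + (-t - b)) := by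
    rw [eT₁', hT₁b]; exact sumset₃_singleton_shift S₀ U₀ (-t) b
  have hsub := near_shift_subset (-c₀ - b - t) (-t - b) hp hP'Q' hQ'R' hP' hR' hQ'e
  have e : -t - b - (-c₀ - b - t) = c₀ := by abel
  rw [e] at hsub
  refine periodic_of_subset_insert hc₀ h2c hsub ?_
  rw [cs false true false mS₀ mT₁ mU₀, hT₁b, card_singleton, hu₀, hs]
  omega

/-- **Structure theorem for P3 in dicyclic type: the big `ρ`-part of `S` is `⟨c₀⟩`-periodic.**  Dicyclic type
(`c₀ ≠ 0`); a TPP triple with coset parts `(s₁+1, s₁ | 1,1 | 3,3)` attaining `3|S||T||U| + 20 = 8|A|` has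
`S₀ + c₀ = S₀`. [folklore] -/
theorem dicyclic_P3_rho_part_periodic
    (hρρ : ∀ a b, ρ a * ρ b = ρ (a + b)) (hρτ : ∀ a b, ρ a * τ b = τ (b - a))
    (hτρ : ∀ a b, τ a * ρ b = τ (a + b)) (hττ : ∀ a b, τ a * τ b = ρ (c₀ + b - a)) (hc₀ : c₀ ≠ 0)
    (hρ : Function.Injective ρ) (hτ : Function.Injective τ) (hne : ∀ a b, ρ a ≠ τ b)
    (hsurj : ∀ g, (∃ a, ρ a = g) ∨ (∃ a, τ a = g)) (h : TripleProductProperty S T U)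
    (hs : (univ.filter fun a : A => ρ a ∈ S).card = (univ.filter fun a : A => τ a ∈ S).card + 1)
    (ht₀ : (univ.filter fun a : A => ρ a ∈ T).card = 1) (ht₁ : (univ.filter fun a : A => τ a ∈ T).card = 1)
    (hu₀ : (univ.filter fun a : A => ρ a ∈ U).card = 3) (hu₁ : (univ.filter fun a : A => τ a ∈ U).card = 3)
    (hV : 3 * (S.card * T.card * U.card) + 20 = 8 * Fintype.card A) :
    (univ.filter fun a : A => ρ a ∈ S).image (· + c₀) = (univ.filter fun a : A => ρ a ∈ S) := by
  set S₀ : Finset A := univ.filter fun a => ρ a ∈ S with hS₀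
  set S₁ : Finset A := univ.filter fun a => τ a ∈ S with hS₁
  set T₀ : Finset A := univ.filter fun a => ρ a ∈ T with hT₀
  set T₁ : Finset A := univ.filter fun a => τ a ∈ T with hT₁
  set U₀ : Finset A := univ.filter fun a => ρ a ∈ U with hU₀
  set U₁ : Finset A := univ.filter fun a => τ a ∈ U with hU₁
  have h2c := two_c0_eq_zero hρτ hτρ hττ hτ
  obtain ⟨t, hT₀t⟩ := card_eq_one.1 ht₀
  obtain ⟨b, hT₁b⟩ := card_eq_one.1 ht₁
  have mS₀ : ∀ a ∈ S₀, cond false (τ a) (ρ a) ∈ S := fun a ha => by simpa [hS₀] using ha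
  have mS₁ : ∀ a ∈ S₁, cond true (τ a) (ρ a) ∈ S := fun a ha => by simpa [hS₁] using ha
  have mT₀ : ∀ a ∈ T₀, cond false (τ a) (ρ a) ∈ T := fun a ha => by simpa [hT₀] using ha
  have mT₁ : ∀ a ∈ T₁, cond true (τ a) (ρ a) ∈ T := fun a ha => by simpa [hT₁] using ha
  have mU₀ : ∀ a ∈ U₀, cond false (τ a) (ρ a) ∈ U := fun a ha => by simpa [hU₀] using ha
  -- (1) the box `S₀ + T₁ + U₀` is periodic
  have hQ := P3_face_periodic hρρ hρτ hτρ hττ hc₀ hρ hτ hne hsurj h hs ht₀ ht₁ hu₀ hu₁ hV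
  -- (2) the `U`-translate `(S, T, U·τ0)`, parts `(c₀ − U₁, −U₀)`
  have er : (Equiv.mulRight (1 : G)).toEmbedding = Function.Embedding.refl G := by ext x; simp
  have hU' := h.map_mulRight 1 1 (τ 0)
  simp only [er, Finset.map_refl] at hU'
  set U' := U.map (Equiv.mulRight (τ 0)).toEmbedding with hU'def
  set U₀' : Finset A := univ.filter fun a => ρ a ∈ U' with hU₀'
  set U₁' : Finset A := univ.filter fun a => τ a ∈ U' with hU₁'
  have eU₀' : U₀' = U₁.image fun b => -c₀ - b := by rw [hU₀', hU'def, rho_part_mulRight_tau hρρ hρτ hττ]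
  have eU₁' : U₁' = U₀.image fun b => -b := by rw [hU₁', hU'def, tau_part_mulRight_tau hρρ hττ]
  have cU₀' : U₀'.card = 3 := by rw [eU₀', card_image_of_injective _ (sub_right_injective), hu₁]
  have cU₁' : U₁'.card = 3 := by rw [eU₁', card_image_of_injective _ neg_injective, hu₀]
  have mU₀' : ∀ a ∈ U₀', cond false (τ a) (ρ a) ∈ U' := fun a ha => by simpa [hU₀'] using ha
  have hV' : 3 * (S.card * T.card * U'.card) + 20 = 8 * Fintype.card A := by rw [hU'def, card_map]; exact hV
  have hQ₂ := P3_face_periodic hρρ hρτ hτρ hττ hc₀ hρ hτ hne hsurj hU' hs ht₀ ht₁ cU₀' cU₁' hV'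
  -- vertex 000 of the `U`-translate as a character identity
  have cs' := card_sumset' hρρ hττ hρ hτ hU'
  have inj := sum_injOn' hρρ hττ hρ hτ h
  have inj' := sum_injOn' hρρ hττ hρ hτ hU'
  have cS : S.card = S₀.card + S₁.card := card_eq_parts' hρ hτ hne hsurj S
  have cT : T.card = T₀.card + T₁.card := card_eq_parts' hρ hτ hne hsurj T
  have cU : U.card = U₀.card + U₁.card := card_eq_parts' hρ hτ hne hsurj U
  have hN : S₁.card * 1 * 3 + (S₁.card + 1) * 1 * 3 + (S₁.card + 1) * 1 * 3 + 1 = Fintype.card A := by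
    rw [cS, cT, cU, hs, ht₀, ht₁, hu₀, hu₁] at hV
    omega
  obtain ⟨x, hx⟩ := vertex000_charsum hρρ hρτ hτρ hττ hρ hτ hne hU' (by
    have e1 : (univ.filter fun a : A => τ a ∈ S).card = S₁.card := rfl
    have e2 : (univ.filter fun a : A => ρ a ∈ S).card = S₀.card := rfl
    have e3 : (univ.filter fun a : A => ρ a ∈ T).card = T₀.card := rfl
    have e4 : (univ.filter fun a : A => τ a ∈ T).card = T₁.card := rfl
    have e5 : (univ.filter fun a : A => ρ a ∈ U').card = U₀'.card := rfl
    have e6 : (univ.filter fun a : A => τ a ∈ U').card = U₁'.card := rfl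
    rw [e1, e2, e3, e4, e5, e6, cU₀', cU₁', ht₀, ht₁, hs]
    exact hN)
  -- (3) Fourier
  refine periodic_of_charsum_eq_zero h2c fun ψ hψ => ?_
  by_contra hσ
  have hψ0 : ψ ≠ 0 := by rintro rfl; rw [AddChar.zero_apply] at hψ; norm_num at hψ
  have hb0 : ψ b ≠ 0 := addChar_ne_zero ψ b
  have hx0 : ψ x ≠ 0 := addChar_ne_zero ψ x
  -- `σ₀ ψ(b) υ₀ = 0` from the periodic box of `(S, T, U)`
  have z1 := charsum_eq_zero_of_periodic hQ hψ
  rw [charsum_sumset' ψ (inj false true false mS₀ mT₁ mU₀), hT₁b, sum_singleton] at z1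
  have hu0 : ∑ c ∈ U₀, ψ c = 0 := by
    rcases mul_eq_zero.1 z1 with h1 | h1
    · rcases mul_eq_zero.1 h1 with h2 | h2
      · exact absurd h2 hσ
      · exact absurd h2 hb0
    · exact h1
  -- `σ₀ ψ(b) ψ̂(U₀') = 0` from the periodic box of `(S, T, U·τ0)`
  have z2 := charsum_eq_zero_of_periodic hQ₂ hψ
  rw [charsum_sumset' ψ (inj' false true false mS₀ mT₁ mU₀'), hT₁b, sum_singleton] at z2
  have hu0' : ∑ c ∈ U₀', ψ c = 0 := by
    rcases mul_eq_zero.1 z2 with h1 | h1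
    · rcases mul_eq_zero.1 h1 with h2 | h2
      · exact absurd h2 hσ
      · exact absurd h2 hb0
    · exact h1
  -- `ψ̂(U₁') = ψ̂(−U₀) = conj υ₀ = 0`
  have hu1' : ∑ c ∈ U₁', ψ c = 0 := by
    rw [eU₁', sum_image fun x _ y _ h => neg_injective h, ← conj_charsum', hu0, map_zero]
  -- the vertex identity collapses to `0 = −ψ x`
  have key := hx ψ hψ0
  rw [hu0', hu1'] at key
  simp only [mul_zero, add_zero] at key
  exact hx0 (neg_eq_zero.1 key.symm)

end DihedralLike

end Summit.MatrixMultiplication.OmegaCensus
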